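import Literature.Analysis.FluidPDE.ElgindiBoundaryModulus
import Literature.Analysis.FluidPDE.ElgindiStripIterates
import Literature.Analysis.FluidPDE.ElgindiMomentCalculus
import HarnessLib

/-!
# Uniform estimates for the tangential family at the angular boundary, and continuity up to `θ = 0`
([Elgindi2021] §7.1 Proposition 7.1: boundary behaviour of the `L²` solution)

Topic `Literature/Analysis/FluidPDE`. Support file (definitions with bodies and proved theorems, no
named facts) on the proof path of the named fact
`Literature.Analysis.FluidPDE.Elgindi.ElgindiGhoulMasmoudi2021_stabilityCore`
(`ElgindiStabilityDecomposition.lean`). T. M. Elgindi, Ann. of Math. 194 (2021) =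
arXiv:1904.04795, §7.1 Proposition 7.1 (p. 19) and §7 eq. (PolarBSL).

Setting (`TangentialFamily`): `Ψ ∈ C^∞(strip)` whose radial iterates `V_k = D_R^kΨ` all satisfy
the polar equation `L(V_k) = D_R^kf` on the strip (a smooth compactly supported datum `f`), have
finite tangential energies `V_k, ∂_θV_k ∈ L²(strip)` and finite Hardy energy
`V_k/sin(2θ) ∈ L²(strip)` (all supplied by the energy space, `ElgindiTangentialRegularity.lean`,
`ElgindiSliceBoundary.lean`). We prove, for every `k` and every compact radial range `[a,b]`:
* uniform decay at both angular ends, `V_k(R,θ)² ≤ θ·S`, `V_k(R,θ)² ≤ (π/2 − θ)·S`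
  (`sq_le_near_boundary`);
* uniform slice bounds `∫(V_k)², ∫(∂_θV_k)² ≤ T` (`slice_sq_bounds`);
* near `θ = 0`: `∂_θθV_k ∈ L²(0,π/4)` uniformly (from the equation solved for `∂_θθ`), hence
  a limit `c_k(R) = ∂_θV_k(R,0⁺)` with the rate `√θ` (`dθ_rate_zero`), and joint continuity up to
  `θ = 0` of `V_k` (extended by `0`) and of `∂_θV_k` (extended by `c_k`)
  (`continuousOn_ext_zero`, `continuousOn_dθ_ext_zero`).
-/

noncomputable section

open MeasureTheory Set Real Filter Function
open _root_.Topology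
open scoped ContDiff

namespace Literature.Analysis.FluidPDE

namespace Elgindi

/-- **The tangential family of a smooth function on the strip**: all radial iterates solve the
commuted polar equation and carry finite tangential and Hardy energies. [cite: Elgindi2021, §7.1 Proposition 7.1 and §7.3 Step 3 (pp. 19, 21 of arXiv:1904.04795)] -/
structure TangentialFamily (α : ℝ) (f Ψ : ℝ → ℝ → ℝ) : Prop where
  smooth : ContDiffOn ℝ ∞ (uncurry Ψ) strip
  datum_smooth : ∀ n : ℕ, ContDiff ℝ n (uncurry f)
  datum_supp : HasCompactSupport (uncurry f)
  eqn : ∀ k : ℕ, ∀ p ∈ strip, ellipticOp α (Dz^[k] Ψ) p.1 p.2 = (Dz^[k] f) p.1 p.2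
  sq_int : ∀ k : ℕ, IntegrableOn (fun p : ℝ × ℝ => (Dz^[k] Ψ) p.1 p.2 ^ 2) strip
  dθ_sq_int : ∀ k : ℕ, IntegrableOn (fun p : ℝ × ℝ => dθ (Dz^[k] Ψ) p.1 p.2 ^ 2) strip
  hardy_int : ∀ k : ℕ, IntegrableOn (fun p : ℝ × ℝ => (Dz^[k] Ψ) p.1 p.2 ^ 2 / Real.sin (2 * p.2) ^ 2) strip

namespace TangentialFamily

variable {α : ℝ} {f Ψ : ℝ → ℝ → ℝ} (h : TangentialFamily α f Ψ)
include h

/-- Every iterate is `C^∞` on the strip. [folklore] -/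
theorem smooth_iterate (k : ℕ) : ContDiffOn ℝ ∞ (uncurry (Dz^[k] Ψ)) strip := by
  have e : Ψ = fun R θ => (uncurry Ψ) (R, θ) := by funext R θ; rfl
  have := contDiffOn_iterate_Dz_strip (Ψ := uncurry Ψ) h.smooth k
  rw [e]; exact this

omit h in
/-- The next iterate is `D_R` of the previous one. [folklore] -/
theorem iterate_succ (k : ℕ) : (Dz^[k + 1] Ψ) = Dz (Dz^[k] Ψ) := Function.iterate_succ_apply' Dz k Ψ

omit h in
/-- The second next iterate. [folklore] -/
theorem iterate_succ_succ (k : ℕ) : (Dz^[k + 2] Ψ) = Dz^[2] (Dz^[k] Ψ) := by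
  rw [show k + 2 = k + 1 + 1 by ring, Function.iterate_succ_apply', Function.iterate_succ_apply']; rfl

/-- The datum iterates are continuous and bounded. [folklore] -/
theorem datum_bound (k : ℕ) : ∃ C, ∀ p : ℝ × ℝ, |(Dz^[k] f) p.1 p.2| ≤ C := by
  have hc : Continuous (uncurry (Dz^[k] f)) := (contDiff_iterate_Dz_of_contDiff (n := 0) (m := k) (by simpa using h.datum_smooth (0 + k))).continuous
  have hs : HasCompactSupport (uncurry (Dz^[k] f)) := hasCompactSupport_iterate_Dz h.datum_supp k
  obtain ⟨C, hC⟩ := (hc.norm).bddAbove_range_of_hasCompactSupport hs.norm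
  exact ⟨C, fun p => hC ⟨(p.1, p.2), rfl⟩⟩

/-! ### Slices: boundary values and `L²` bounds, uniformly on compact radial ranges -/

/-- **Boundary behaviour of every iterate, slice by slice.** [folklore] -/
theorem slice (k : ℕ) {R : ℝ} (hR : 0 < R) :
    IntegrableOn (fun θ => dθ (Dz^[k] Ψ) R θ ^ 2) (Ioo 0 (π / 2)) ∧
    IntegrableOn (fun θ => (Dz^[k] Ψ) R θ ^ 2 / Real.sin (2 * θ) ^ 2) (Ioo 0 (π / 2)) ∧
    Tendsto (fun θ => (Dz^[k] Ψ) R θ) (𝓝[>] 0) (𝓝 0) ∧ Tendsto (fun θ => (Dz^[k] Ψ) R θ) (𝓝[<] (π / 2)) (𝓝 0) := by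
  have h1 := h.hardy_int (k + 1); rw [iterate_succ] at h1
  have h2 := h.dθ_sq_int (k + 1); rw [iterate_succ] at h2
  exact slice_boundary (h.smooth_iterate k) (h.hardy_int k) h1 (h.dθ_sq_int k) h2 hR

omit h in
/-- The radial derivative of an iterate in terms of the next one: `∂_RV_k = V_{k+1}/R`. [folklore] -/
theorem dz_iterate {k : ℕ} {p : ℝ × ℝ} (hp : p ∈ strip) : dz (Dz^[k] Ψ) p.1 p.2 = p.1⁻¹ * (Dz^[k + 1] Ψ) p.1 p.2 := by
  rw [iterate_succ]
  show dz (Dz^[k] Ψ) p.1 p.2 = p.1⁻¹ * (p.1 * dz (Dz^[k] Ψ) p.1 p.2)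
  rw [← mul_assoc, inv_mul_cancel₀ (ne_of_gt hp.1), one_mul]

/-- **Uniform slice bounds on `[a,b]`**: `∫(V_k)²`, `∫(∂_θV_k)² ≤ T`. [folklore] -/
theorem slice_sq_bounds (k : ℕ) {a b : ℝ} (ha : 0 < a) (hab : a < b) :
    ∃ T : ℝ, 0 ≤ T ∧ ∀ R ∈ Icc a b,
      IntegrableOn (fun θ => (Dz^[k] Ψ) R θ ^ 2) (Ioo 0 (π / 2)) ∧ (∫ θ in Ioo 0 (π / 2), (Dz^[k] Ψ) R θ ^ 2) ≤ T ∧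
      IntegrableOn (fun θ => dθ (Dz^[k] Ψ) R θ ^ 2) (Ioo 0 (π / 2)) ∧ (∫ θ in Ioo 0 (π / 2), dθ (Dz^[k] Ψ) R θ ^ 2) ≤ T := by
  have hQ : Ioo a b ×ˢ Ioo 0 (π / 2) ⊆ strip := fun p hp => ⟨ha.trans hp.1.1, hp.2⟩
  have hQm : MeasurableSet (Ioo a b ×ˢ Ioo (0:ℝ) (π / 2)) := measurableSet_Ioo.prod measurableSet_Ioo
  -- `G = V_k`
  have hG1 : ContDiffOn ℝ 1 (uncurry (Dz^[k] Ψ)) strip := contDiffOn_nat_of_infty (h.smooth_iterate k) 1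
  have iG : IntegrableOn (fun p : ℝ × ℝ => (Dz^[k] Ψ) p.1 p.2 ^ 2) (Ioo a b ×ˢ Ioo 0 (π / 2)) := (h.sq_int k).mono_set hQ
  have iG' : IntegrableOn (fun p : ℝ × ℝ => dz (Dz^[k] Ψ) p.1 p.2 ^ 2) (Ioo a b ×ˢ Ioo 0 (π / 2)) := by
    have hc : ContinuousOn (fun p : ℝ × ℝ => dz (Dz^[k] Ψ) p.1 p.2 ^ 2) (Ioo a b ×ˢ Ioo 0 (π / 2)) :=
      ((contDiffOn_dz (n := 0) (by simpa using hG1)).continuousOn.mono hQ).pow 2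
    refine Integrable.mono' (((h.sq_int (k + 1)).mono_set hQ).const_mul (a⁻¹ ^ 2)) (hc.aestronglyMeasurable hQm) ?_
    rw [ae_restrict_iff' hQm]
    refine ae_of_all _ fun p hp => ?_
    rw [Real.norm_eq_abs, abs_of_nonneg (sq_nonneg _), dz_iterate (hQ hp), mul_pow]
    have hp1 : a < p.1 := hp.1.1
    have hinv : p.1⁻¹ ≤ a⁻¹ := by rw [inv_le_inv₀ (ha.trans hp1) ha]; exact hp1.le
    exact mul_le_mul_of_nonneg_right (pow_le_pow_left₀ (inv_nonneg.2 (ha.trans hp1).le) hinv 2) (sq_nonneg _)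
  -- `G = ∂_θV_k`
  have hH1 : ContDiffOn ℝ 1 (uncurry (dθ (Dz^[k] Ψ))) strip := contDiffOn_nat_of_infty (contDiffOn_dθ_strip (h.smooth_iterate k)) 1
  have hV2 : ContDiffOn ℝ 2 (uncurry (Dz^[k] Ψ)) strip := contDiffOn_nat_of_infty (h.smooth_iterate k) 2
  have iH : IntegrableOn (fun p : ℝ × ℝ => dθ (Dz^[k] Ψ) p.1 p.2 ^ 2) (Ioo a b ×ˢ Ioo 0 (π / 2)) := (h.dθ_sq_int k).mono_set hQ
  have hdz : ∀ p ∈ strip, dz (dθ (Dz^[k] Ψ)) p.1 p.2 = p.1⁻¹ * dθ (Dz^[k + 1] Ψ) p.1 p.2 := by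
    intro p hp
    rw [← dθ_dz_eq_dz_dθ hV2 hp, iterate_succ]
    have e : dθ (Dz (Dz^[k] Ψ)) p.1 p.2 = p.1 * dθ (dz (Dz^[k] Ψ)) p.1 p.2 := by
      show deriv (fun θ' => p.1 * dz (Dz^[k] Ψ) p.1 θ') p.2 = _
      exact deriv_const_mul_field _
    rw [e, ← mul_assoc, inv_mul_cancel₀ (ne_of_gt hp.1), one_mul]
  have iH' : IntegrableOn (fun p : ℝ × ℝ => dz (dθ (Dz^[k] Ψ)) p.1 p.2 ^ 2) (Ioo a b ×ˢ Ioo 0 (π / 2)) := by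
    have hc : ContinuousOn (fun p : ℝ × ℝ => dz (dθ (Dz^[k] Ψ)) p.1 p.2 ^ 2) (Ioo a b ×ˢ Ioo 0 (π / 2)) :=
      ((contDiffOn_dz (n := 0) (by simpa using hH1)).continuousOn.mono hQ).pow 2
    have iN : IntegrableOn (fun p : ℝ × ℝ => dθ (Dz^[k + 1] Ψ) p.1 p.2 ^ 2) (Ioo a b ×ˢ Ioo 0 (π / 2)) := (h.dθ_sq_int (k + 1)).mono_set hQ
    refine Integrable.mono' (iN.const_mul (a⁻¹ ^ 2)) (hc.aestronglyMeasurable hQm) ?_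
    rw [ae_restrict_iff' hQm]
    refine ae_of_all _ fun p hp => ?_
    rw [Real.norm_eq_abs, abs_of_nonneg (sq_nonneg _), hdz p (hQ hp), mul_pow]
    have hp1 : a < p.1 := hp.1.1
    have hinv : p.1⁻¹ ≤ a⁻¹ := by rw [inv_le_inv₀ (ha.trans hp1) ha]; exact hp1.le
    exact mul_le_mul_of_nonneg_right (pow_le_pow_left₀ (inv_nonneg.2 (ha.trans hp1).le) hinv 2) (sq_nonneg _)
  set T₁ := 2 / (b - a) * (∫ p in Ioo a b ×ˢ Ioo 0 (π / 2), (Dz^[k] Ψ) p.1 p.2 ^ 2) + 2 * (b - a) * ∫ p in Ioo a b ×ˢ Ioo 0 (π / 2), dz (Dz^[k] Ψ) p.1 p.2 ^ 2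
  set T₂ := 2 / (b - a) * (∫ p in Ioo a b ×ˢ Ioo 0 (π / 2), dθ (Dz^[k] Ψ) p.1 p.2 ^ 2) + 2 * (b - a) * ∫ p in Ioo a b ×ˢ Ioo 0 (π / 2), dz (dθ (Dz^[k] Ψ)) p.1 p.2 ^ 2
  have hT₁ : 0 ≤ T₁ := by
    have hba : 0 < b - a := by linarith
    have i1 : 0 ≤ ∫ p in Ioo a b ×ˢ Ioo 0 (π / 2), (Dz^[k] Ψ) p.1 p.2 ^ 2 := setIntegral_nonneg hQm fun p _ => sq_nonneg _
    have i2 : 0 ≤ ∫ p in Ioo a b ×ˢ Ioo 0 (π / 2), dz (Dz^[k] Ψ) p.1 p.2 ^ 2 := setIntegral_nonneg hQm fun p _ => sq_nonneg _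
    positivity
  have hT₂ : 0 ≤ T₂ := by
    have hba : 0 < b - a := by linarith
    have i1 : 0 ≤ ∫ p in Ioo a b ×ˢ Ioo 0 (π / 2), dθ (Dz^[k] Ψ) p.1 p.2 ^ 2 := setIntegral_nonneg hQm fun p _ => sq_nonneg _
    have i2 : 0 ≤ ∫ p in Ioo a b ×ˢ Ioo 0 (π / 2), dz (dθ (Dz^[k] Ψ)) p.1 p.2 ^ 2 := setIntegral_nonneg hQm fun p _ => sq_nonneg _
    positivity
  refine ⟨max T₁ T₂, le_max_of_le_left hT₁, fun R hR => ?_⟩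
  obtain ⟨i1, b1⟩ := integral_slice_sq_le hG1 ha hab iG iG' hR
  obtain ⟨i2, b2⟩ := integral_slice_sq_le hH1 ha hab iH iH' hR
  exact ⟨i1, b1.trans (le_max_left _ _), i2, b2.trans (le_max_right _ _)⟩

/-- Angular slices of an iterate have the expected derivative inside the strip. [folklore] -/
theorem hasDerivAt_theta (k : ℕ) {R : ℝ} (hR : 0 < R) {θ : ℝ} (hθ : θ ∈ Ioo 0 (π / 2)) :
    HasDerivAt (fun θ' => (Dz^[k] Ψ) R θ') (dθ (Dz^[k] Ψ) R θ) θ := by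
  have hp : (R, θ) ∈ strip := ⟨hR, hθ⟩
  have hd : DifferentiableAt ℝ (uncurry (Dz^[k] Ψ)) (R, θ) :=
    differentiableAt_of_contDiffOn_strip (contDiffOn_nat_of_infty (h.smooth_iterate k) 1) (by simp) hp
  have hc : HasDerivAt (fun θ' : ℝ => (R, θ')) ((0 : ℝ), (1 : ℝ)) θ := (hasDerivAt_const θ R).prodMk (hasDerivAt_id θ)
  have h' := hd.hasFDerivAt.comp_hasDerivAt θ hc
  have e : (fun θ' => (Dz^[k] Ψ) R θ') = uncurry (Dz^[k] Ψ) ∘ fun θ' => (R, θ') := rfl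
  show HasDerivAt (fun θ' => (Dz^[k] Ψ) R θ') (deriv (fun θ' => (Dz^[k] Ψ) R θ') θ) θ
  rw [e, h'.deriv]; exact h'

/-- Angular slices of `∂_θ` of an iterate have the expected derivative inside the strip. [folklore] -/
theorem hasDerivAt_theta_dθ (k : ℕ) {R : ℝ} (hR : 0 < R) {θ : ℝ} (hθ : θ ∈ Ioo 0 (π / 2)) :
    HasDerivAt (fun θ' => dθ (Dz^[k] Ψ) R θ') (dθ (dθ (Dz^[k] Ψ)) R θ) θ := by
  have hp : (R, θ) ∈ strip := ⟨hR, hθ⟩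
  have hd : DifferentiableAt ℝ (uncurry (dθ (Dz^[k] Ψ))) (R, θ) :=
    differentiableAt_of_contDiffOn_strip (contDiffOn_nat_of_infty (contDiffOn_dθ_strip (h.smooth_iterate k)) 1) (by simp) hp
  have hc : HasDerivAt (fun θ' : ℝ => (R, θ')) ((0 : ℝ), (1 : ℝ)) θ := (hasDerivAt_const θ R).prodMk (hasDerivAt_id θ)
  have h' := hd.hasFDerivAt.comp_hasDerivAt θ hc
  have e : (fun θ' => dθ (Dz^[k] Ψ) R θ') = uncurry (dθ (Dz^[k] Ψ)) ∘ fun θ' => (R, θ') := rfl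
  show HasDerivAt (fun θ' => dθ (Dz^[k] Ψ) R θ') (deriv (fun θ' => dθ (Dz^[k] Ψ) R θ') θ) θ
  rw [e, h'.deriv]; exact h'

/-- Continuity of angular slices of (derivatives of) the iterates on `(0, π/2)`. [folklore] -/
theorem continuousOn_theta_slice {g : ℝ → ℝ → ℝ} (hg : ContDiffOn ℝ ∞ (uncurry g) strip) {R : ℝ} (hR : 0 < R) :
    ContinuousOn (fun θ => g R θ) (Ioo 0 (π / 2)) := by
  have := h
  exact hg.continuousOn.comp (continuous_const.prodMk continuous_id).continuousOn fun θ hθ => ⟨hR, hθ⟩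

/-- **Uniform decay at both angular ends**: on `R ∈ [a,b]`, `V_k(R,θ)² ≤ θ·S` and
`V_k(R,θ)² ≤ (π/2 − θ)·S`. [cite: Elgindi2021, §7.1 Proposition 7.1 (p. 19 of arXiv:1904.04795)] -/
theorem sq_le_near_boundary (k : ℕ) {a b : ℝ} (ha : 0 < a) (hab : a < b) :
    ∃ S : ℝ, 0 ≤ S ∧ ∀ R ∈ Icc a b, ∀ θ ∈ Ioo 0 (π / 2),
      (Dz^[k] Ψ) R θ ^ 2 ≤ θ * S ∧ (Dz^[k] Ψ) R θ ^ 2 ≤ (π / 2 - θ) * S := by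
  obtain ⟨T, hT0, hT⟩ := h.slice_sq_bounds k ha hab
  refine ⟨T, hT0, fun R hR θ hθ => ?_⟩
  have hRpos : 0 < R := ha.trans_le hR.1
  obtain ⟨-, -, iY, bY⟩ := hT R hR
  obtain ⟨-, -, h0, h1⟩ := h.slice k hRpos
  have hy := fun t (ht : t ∈ Ioo (0:ℝ) (π / 2)) => h.hasDerivAt_theta k hRpos ht
  have hy'c : ContinuousOn (fun t => dθ (Dz^[k] Ψ) R t) (Ioo 0 (π / 2)) :=
    h.continuousOn_theta_slice (contDiffOn_dθ_strip (h.smooth_iterate k)) hRpos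
  have hL := sq_le_mul_integral_of_tendsto_zero_left hy hy'c iY h0 hθ
  have hRt := sq_le_mul_integral_of_tendsto_zero_right hy hy'c iY h1 hθ
  rw [sub_zero] at hL
  exact ⟨hL.trans (mul_le_mul_of_nonneg_left bY hθ.1.le), hRt.trans (mul_le_mul_of_nonneg_left bY (by linarith [hθ.2]))⟩

/-! ### Near `θ = 0`: `∂_θθV_k ∈ L²(0,π/4)` uniformly, the limit `∂_θV_k(R,0⁺)`, and its rate -/

/-- The equation solved for `∂_θθV_k` on the strip. [folklore] -/
theorem dθdθ_iterate_eq (k : ℕ) {p : ℝ × ℝ} (hp : p ∈ strip) :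
    dθ (dθ (Dz^[k] Ψ)) p.1 p.2 = Real.tan p.2 * dθ (Dz^[k] Ψ) p.1 p.2 + (Dz^[k] Ψ) p.1 p.2 / Real.cos p.2 ^ 2 -
      6 * (Dz^[k] Ψ) p.1 p.2 - (Dz^[k] f) p.1 p.2 -
      α ^ 2 * ((Dz^[k + 2] Ψ) p.1 p.2 - (Dz^[k + 1] Ψ) p.1 p.2) - α * (5 + α) * (Dz^[k + 1] Ψ) p.1 p.2 := by
  rw [dθdθ_eq_of_ellipticOp_eq (h.smooth_iterate k) hp (h.eqn k p hp), ← iterate_succ_succ (Ψ := Ψ) k, ← iterate_succ (Ψ := Ψ) k]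

set_option maxHeartbeats 1600000 in
/-- **`∂_θθV_k ∈ L²(0,π/4)` uniformly on `R ∈ [a,b]`.** [folklore] -/
theorem dθdθ_sq_bound (k : ℕ) {a b : ℝ} (ha : 0 < a) (hab : a < b) :
    ∃ M : ℝ, 0 ≤ M ∧ ∀ R ∈ Icc a b,
      IntegrableOn (fun θ => dθ (dθ (Dz^[k] Ψ)) R θ ^ 2) (Ioo 0 (π / 4)) ∧
      (∫ θ in Ioo 0 (π / 4), dθ (dθ (Dz^[k] Ψ)) R θ ^ 2) ≤ M := by
  obtain ⟨T₀, hT₀0, hT₀⟩ := h.slice_sq_bounds k ha hab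
  obtain ⟨T₁, hT₁0, hT₁⟩ := h.slice_sq_bounds (k + 1) ha hab
  obtain ⟨T₂, hT₂0, hT₂⟩ := h.slice_sq_bounds (k + 2) ha hab
  obtain ⟨C, hC⟩ := h.datum_bound k
  have hC0 : 0 ≤ C := (abs_nonneg _).trans (hC (1, 1))
  set M : ℝ := 6 * (T₀ + 4 * T₀ + 36 * T₀ + π / 4 * C ^ 2 + α ^ 4 * T₂ + (α ^ 2 - α * (5 + α)) ^ 2 * T₁) with hM
  have hπ4 : (0:ℝ) < π / 4 := by positivity
  have hsub : Ioo (0:ℝ) (π / 4) ⊆ Ioo 0 (π / 2) := Ioo_subset_Ioo le_rfl (by linarith [Real.pi_pos])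
  refine ⟨M, by positivity, fun R hR => ?_⟩
  have hRpos : 0 < R := ha.trans_le hR.1
  obtain ⟨iV, bV, iY, bY⟩ := hT₀ R hR
  obtain ⟨iV1, bV1, -, -⟩ := hT₁ R hR
  obtain ⟨iV2, bV2, -, -⟩ := hT₂ R hR
  -- the pointwise bound on `(0, π/4)`
  set F : ℝ → ℝ := fun θ => 6 * (dθ (Dz^[k] Ψ) R θ ^ 2 + 4 * (Dz^[k] Ψ) R θ ^ 2 + 36 * (Dz^[k] Ψ) R θ ^ 2 + C ^ 2 +
      α ^ 4 * (Dz^[k + 2] Ψ) R θ ^ 2 + (α ^ 2 - α * (5 + α)) ^ 2 * (Dz^[k + 1] Ψ) R θ ^ 2) with hF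
  have hpt : ∀ θ ∈ Ioo (0:ℝ) (π / 4), dθ (dθ (Dz^[k] Ψ)) R θ ^ 2 ≤ F θ := by
    intro θ hθ
    have hθ' := hsub hθ
    rw [h.dθdθ_iterate_eq k (p := (R, θ)) ⟨hRpos, hθ'⟩]
    simp only [hF]
    have hcos : Real.cos (π / 4) ≤ Real.cos θ :=
      Real.cos_le_cos_of_nonneg_of_le_pi hθ.1.le (by linarith [Real.pi_pos]) hθ.2.le
    rw [Real.cos_pi_div_four] at hcos
    have hcpos : 0 < Real.cos θ := Real.cos_pos_of_mem_Ioo ⟨by linarith [hθ.1], by linarith [hθ'.2]⟩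
    have hc2 : 1 / 2 ≤ Real.cos θ ^ 2 := by
      have h2 : Real.sqrt 2 ^ 2 = 2 := Real.sq_sqrt (by norm_num)
      nlinarith [Real.sqrt_nonneg 2]
    have htan : Real.tan θ ^ 2 ≤ 1 := by
      have ht0 : 0 ≤ Real.tan θ := Real.tan_nonneg_of_nonneg_of_le_pi_div_two hθ.1.le (by linarith [hθ'.2])
      have ht1 : Real.tan θ ≤ 1 := by
        rw [← Real.tan_pi_div_four]
        exact Real.strictMonoOn_tan.monotoneOn ⟨by linarith [hθ.1, Real.pi_pos], hθ'.2⟩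
          ⟨by linarith [Real.pi_pos], by linarith [Real.pi_pos]⟩ hθ.2.le
      nlinarith
    set y := dθ (Dz^[k] Ψ) R θ
    set v := (Dz^[k] Ψ) R θ
    set v1 := (Dz^[k + 1] Ψ) R θ
    set v2 := (Dz^[k + 2] Ψ) R θ
    set d := (Dz^[k] f) R θ
    have hd : d ^ 2 ≤ C ^ 2 := by
      have := hC (R, θ); rw [← sq_abs d]; exact pow_le_pow_left₀ (abs_nonneg _) this 2
    -- six terms
    set a1 := Real.tan θ * y
    set a2 := v / Real.cos θ ^ 2
    set a3 := -(6 * v)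
    set a4 := -d
    set a5 := -(α ^ 2 * v2)
    set a6 := (α ^ 2 - α * (5 + α)) * v1
    have esum : Real.tan θ * y + v / Real.cos θ ^ 2 - 6 * v - d - α ^ 2 * (v2 - v1) - α * (5 + α) * v1 = a1 + a2 + a3 + a4 + a5 + a6 := by
      simp only [a1, a2, a3, a4, a5, a6]; ring
    rw [esum]
    have hCS : (a1 + a2 + a3 + a4 + a5 + a6) ^ 2 ≤ 6 * (a1 ^ 2 + a2 ^ 2 + a3 ^ 2 + a4 ^ 2 + a5 ^ 2 + a6 ^ 2) := by
      have e : 6 * (a1 ^ 2 + a2 ^ 2 + a3 ^ 2 + a4 ^ 2 + a5 ^ 2 + a6 ^ 2) - (a1 + a2 + a3 + a4 + a5 + a6) ^ 2 =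
          (a1 - a2) ^ 2 + (a1 - a3) ^ 2 + (a1 - a4) ^ 2 + (a1 - a5) ^ 2 + (a1 - a6) ^ 2 + (a2 - a3) ^ 2 + (a2 - a4) ^ 2 +
            (a2 - a5) ^ 2 + (a2 - a6) ^ 2 + (a3 - a4) ^ 2 + (a3 - a5) ^ 2 + (a3 - a6) ^ 2 + (a4 - a5) ^ 2 + (a4 - a6) ^ 2 +
            (a5 - a6) ^ 2 := by ring
      have : 0 ≤ 6 * (a1 ^ 2 + a2 ^ 2 + a3 ^ 2 + a4 ^ 2 + a5 ^ 2 + a6 ^ 2) - (a1 + a2 + a3 + a4 + a5 + a6) ^ 2 := by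
        rw [e]; positivity
      linarith
    have b1 : a1 ^ 2 ≤ y ^ 2 := by simp only [a1]; rw [mul_pow]; nlinarith [sq_nonneg y]
    have b2 : a2 ^ 2 ≤ 4 * v ^ 2 := by
      simp only [a2]; rw [div_pow, div_le_iff₀ (by positivity)]
      have hc4 : 1 / 4 ≤ (Real.cos θ ^ 2) ^ 2 := by nlinarith [hc2]
      nlinarith [mul_le_mul_of_nonneg_left hc4 (sq_nonneg v)]
    have b3 : a3 ^ 2 = 36 * v ^ 2 := by simp only [a3]; ring
    have b4 : a4 ^ 2 ≤ C ^ 2 := by simp only [a4]; rw [neg_sq]; exact hd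
    have b5 : a5 ^ 2 = α ^ 4 * v2 ^ 2 := by simp only [a5]; ring
    have b6 : a6 ^ 2 = (α ^ 2 - α * (5 + α)) ^ 2 * v1 ^ 2 := by simp only [a6]; ring
    linarith
  -- integrability and the bound
  have hcont : ContinuousOn (fun θ => dθ (dθ (Dz^[k] Ψ)) R θ ^ 2) (Ioo 0 (π / 4)) :=
    ((h.continuousOn_theta_slice (contDiffOn_dθ_strip (contDiffOn_dθ_strip (h.smooth_iterate k))) hRpos).mono hsub).pow 2
  have iF : IntegrableOn F (Ioo 0 (π / 4)) := by
    have i1 := iY.mono_set hsub; have i2 := iV.mono_set hsub; have i3 := iV1.mono_set hsub; have i4 := iV2.mono_set hsub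
    have ic : IntegrableOn (fun _ => C ^ 2) (Ioo (0:ℝ) (π / 4)) volume := integrableOn_const (by simp)
    simp only [hF]
    exact (((((i1.add (i2.const_mul 4)).add (i2.const_mul 36)).add ic).add (i4.const_mul _)).add (i3.const_mul _)).const_mul 6
  have hI : IntegrableOn (fun θ => dθ (dθ (Dz^[k] Ψ)) R θ ^ 2) (Ioo 0 (π / 4)) := by
    refine Integrable.mono' iF (hcont.aestronglyMeasurable measurableSet_Ioo) ?_
    rw [ae_restrict_iff' measurableSet_Ioo]
    exact ae_of_all _ fun θ hθ => by rw [Real.norm_eq_abs, abs_of_nonneg (sq_nonneg _)]; exact hpt θ hθ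
  refine ⟨hI, ?_⟩
  have hle : ∫ θ in Ioo 0 (π / 4), dθ (dθ (Dz^[k] Ψ)) R θ ^ 2 ≤ ∫ θ in Ioo 0 (π / 4), F θ :=
    setIntegral_mono_on hI iF measurableSet_Ioo hpt
  refine hle.trans ?_
  -- evaluate `∫ F` and bound each piece by the uniform slice bounds
  have i1 := iY.mono_set hsub; have i2 := iV.mono_set hsub; have i3 := iV1.mono_set hsub; have i4 := iV2.mono_set hsub
  have ic : IntegrableOn (fun _ => C ^ 2) (Ioo (0:ℝ) (π / 4)) volume := integrableOn_const (by simp)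
  have m1 : ∫ θ in Ioo 0 (π / 4), dθ (Dz^[k] Ψ) R θ ^ 2 ≤ T₀ :=
    (setIntegral_mono_set iY (ae_of_all _ fun _ => sq_nonneg _) (Eventually.of_forall hsub)).trans bY
  have m2 : ∫ θ in Ioo 0 (π / 4), (Dz^[k] Ψ) R θ ^ 2 ≤ T₀ :=
    (setIntegral_mono_set iV (ae_of_all _ fun _ => sq_nonneg _) (Eventually.of_forall hsub)).trans bV
  have m3 : ∫ θ in Ioo 0 (π / 4), (Dz^[k + 1] Ψ) R θ ^ 2 ≤ T₁ :=
    (setIntegral_mono_set iV1 (ae_of_all _ fun _ => sq_nonneg _) (Eventually.of_forall hsub)).trans bV1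
  have m4 : ∫ θ in Ioo 0 (π / 4), (Dz^[k + 2] Ψ) R θ ^ 2 ≤ T₂ :=
    (setIntegral_mono_set iV2 (ae_of_all _ fun _ => sq_nonneg _) (Eventually.of_forall hsub)).trans bV2
  have mc : ∫ θ in Ioo (0:ℝ) (π / 4), C ^ 2 = π / 4 * C ^ 2 := by
    rw [setIntegral_const, smul_eq_mul, measureReal_def, Real.volume_Ioo, ENNReal.toReal_ofReal (by linarith)]; ring
  simp only [hF]
  rw [MeasureTheory.integral_const_mul, integral_add, integral_add, integral_add, integral_add, integral_add,
    MeasureTheory.integral_const_mul, MeasureTheory.integral_const_mul, MeasureTheory.integral_const_mul,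
    MeasureTheory.integral_const_mul, mc]
  · have hα4 : 0 ≤ α ^ 4 := by positivity
    have hα6 : 0 ≤ (α ^ 2 - α * (5 + α)) ^ 2 := sq_nonneg _
    have p4 := mul_le_mul_of_nonneg_left m4 hα4
    have p3 := mul_le_mul_of_nonneg_left m3 hα6
    simp only [hM]
    linarith
  all_goals first
    | exact i1
    | exact i2.const_mul _
    | exact i1.add (i2.const_mul _)
    | exact (i1.add (i2.const_mul _)).add (i2.const_mul _)
    | exact ic
    | exact ((i1.add (i2.const_mul _)).add (i2.const_mul _)).add ic
    | exact i4.const_mul _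
    | exact (((i1.add (i2.const_mul _)).add (i2.const_mul _)).add ic).add (i4.const_mul _)
    | exact i3.const_mul _

end TangentialFamily

/-- **The boundary value `∂_θV_k(R,0⁺)`** (a limit along `θ → 0⁺`; junk if it does not exist). [folklore] -/
def dθZeroLim (Ψ : ℝ → ℝ → ℝ) (k : ℕ) (R : ℝ) : ℝ := limUnder (𝓝[>] (0:ℝ)) fun θ => dθ (Dz^[k] Ψ) R θ

/-- From local radial ranges to the whole half-line. [folklore] -/
theorem continuousOn_Ioi_prod_of_local {F : ℝ × ℝ → ℝ} {T : Set ℝ}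
    (hF : ∀ a b : ℝ, 0 < a → a < b → ContinuousOn F (Ioo a b ×ˢ T)) : ContinuousOn F (Ioi 0 ×ˢ T) := by
  intro p hp
  have hp1 : 0 < p.1 := hp.1
  have h := hF (p.1 / 2) (2 * p.1) (by positivity) (by linarith) p ⟨⟨by linarith, by linarith⟩, hp.2⟩
  refine h.mono_of_mem_nhdsWithin ?_
  have hN : Ioo (p.1 / 2) (2 * p.1) ×ˢ (univ : Set ℝ) ∈ 𝓝 p :=
    (isOpen_Ioo.prod isOpen_univ).mem_nhds ⟨⟨by linarith, by linarith⟩, mem_univ _⟩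
  filter_upwards [inter_mem_nhdsWithin (Ioi 0 ×ˢ T) hN] with q hq
  exact ⟨hq.2.1, hq.1.2⟩

namespace TangentialFamily

variable {α : ℝ} {f Ψ : ℝ → ℝ → ℝ} (h : TangentialFamily α f Ψ)
include h

/-- **The limit `∂_θV_k(R,0⁺)` exists.** [folklore] -/
theorem tendsto_dθ_zero (k : ℕ) {R : ℝ} (hR : 0 < R) :
    Tendsto (fun θ => dθ (Dz^[k] Ψ) R θ) (𝓝[>] 0) (𝓝 (dθZeroLim Ψ k R)) := by
  have hπ4 : (0:ℝ) < π / 4 := by positivity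
  have hsub : Ioo (0:ℝ) (π / 4) ⊆ Ioo 0 (π / 2) := Ioo_subset_Ioo le_rfl (by linarith [Real.pi_pos])
  obtain ⟨M, -, hM⟩ := h.dθdθ_sq_bound k (a := R / 2) (b := 2 * R) (by positivity) (by linarith)
  obtain ⟨hI, -⟩ := hM R ⟨by linarith, by linarith⟩
  have hy := fun t (ht : t ∈ Ioo (0:ℝ) (π / 4)) => h.hasDerivAt_theta_dθ k hR (hsub ht)
  have hy'c : ContinuousOn (fun t => dθ (dθ (Dz^[k] Ψ)) R t) (Ioo 0 (π / 4)) :=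
    (h.continuousOn_theta_slice (contDiffOn_dθ_strip (contDiffOn_dθ_strip (h.smooth_iterate k))) hR).mono hsub
  obtain ⟨-, ⟨L, hL⟩⟩ := exists_tendsto_of_sq_integrable_deriv hπ4 hy hy'c hI
  exact tendsto_nhds_limUnder ⟨L, hL⟩

/-- **Rate at `θ = 0` for `∂_θV_k`**: `|∂_θV_k(R,θ) − ∂_θV_k(R,0⁺)| ≤ M√θ` uniformly on `R ∈ [a,b]`,
`θ ∈ (0,π/4)`. [folklore] -/
theorem dθ_rate_zero (k : ℕ) {a b : ℝ} (ha : 0 < a) (hab : a < b) :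
    ∃ M : ℝ, 0 ≤ M ∧ ∀ R ∈ Icc a b, ∀ θ ∈ Ioo 0 (π / 4), |dθ (Dz^[k] Ψ) R θ - dθZeroLim Ψ k R| ≤ M * Real.sqrt θ := by
  have hsub : Ioo (0:ℝ) (π / 4) ⊆ Ioo 0 (π / 2) := Ioo_subset_Ioo le_rfl (by linarith [Real.pi_pos])
  obtain ⟨M, hM0, hM⟩ := h.dθdθ_sq_bound k ha hab
  refine ⟨Real.sqrt M, Real.sqrt_nonneg _, fun R hR θ hθ => ?_⟩
  have hRpos : 0 < R := ha.trans_le hR.1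
  obtain ⟨hI, hIM⟩ := hM R hR
  have hy := fun t (ht : t ∈ Ioo (0:ℝ) (π / 4)) => h.hasDerivAt_theta_dθ k hRpos (hsub ht)
  have hy'c : ContinuousOn (fun t => dθ (dθ (Dz^[k] Ψ)) R t) (Ioo 0 (π / 4)) :=
    (h.continuousOn_theta_slice (contDiffOn_dθ_strip (contDiffOn_dθ_strip (h.smooth_iterate k))) hRpos).mono hsub
  refine abs_sub_lim_le_of_holder (fun θ₁ θ₂ h₁ h₂ h12 => ?_) (h.tendsto_dθ_zero k hRpos) hθ
  have hsq := sq_sub_le_mul_integral hy hy'c hI h₁ h₂ h12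
  have hsq' : (dθ (Dz^[k] Ψ) R θ₂ - dθ (Dz^[k] Ψ) R θ₁) ^ 2 ≤ (Real.sqrt M * Real.sqrt (θ₂ - θ₁)) ^ 2 := by
    rw [mul_pow, Real.sq_sqrt hM0, Real.sq_sqrt (by linarith)]
    nlinarith [hIM, sub_nonneg.2 h12]
  exact abs_le_of_sq_le_sq hsq' (by positivity)

/-- **Rate at `θ = 0` for `V_k`**: `|V_k(R,θ)| ≤ S√θ` uniformly on `R ∈ [a,b]`. [folklore] -/
theorem rate_zero (k : ℕ) {a b : ℝ} (ha : 0 < a) (hab : a < b) :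
    ∃ S : ℝ, 0 ≤ S ∧ ∀ R ∈ Icc a b, ∀ θ ∈ Ioo 0 (π / 2), |(Dz^[k] Ψ) R θ - 0| ≤ S * Real.sqrt θ := by
  obtain ⟨S, hS0, hS⟩ := h.sq_le_near_boundary k ha hab
  refine ⟨Real.sqrt S, Real.sqrt_nonneg _, fun R hR θ hθ => ?_⟩
  rw [sub_zero]
  have h1 := (hS R hR θ hθ).1
  have : (Dz^[k] Ψ) R θ ^ 2 ≤ (Real.sqrt S * Real.sqrt θ) ^ 2 := by
    rw [mul_pow, Real.sq_sqrt hS0, Real.sq_sqrt hθ.1.le]; linarith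
  exact abs_le_of_sq_le_sq this (by positivity)

/-- **`V_k` extended by `0` is jointly continuous up to `θ = 0`.** [cite: Elgindi2021, §7.1 Proposition 7.1 (p. 19 of arXiv:1904.04795)] -/
theorem continuousOn_ext_zero (k : ℕ) :
    ContinuousOn (fun p : ℝ × ℝ => if p.2 ≤ 0 then 0 else (Dz^[k] Ψ) p.1 p.2) (Ioi 0 ×ˢ Ico 0 (π / 2)) := by
  refine continuousOn_Ioi_prod_of_local fun a b ha hab => ?_
  obtain ⟨S, -, hS⟩ := h.rate_zero k ha hab
  have hG : ContinuousOn (uncurry (Dz^[k] Ψ)) (Ioo a b ×ˢ Ioo 0 (π / 2)) :=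
    (h.smooth_iterate k).continuousOn.mono fun p hp => ⟨ha.trans hp.1.1, hp.2⟩
  have hmd : Tendsto (fun θ => S * Real.sqrt θ) (𝓝[>] 0) (𝓝 0) := by
    have : Tendsto (fun θ => S * Real.sqrt θ) (𝓝 0) (𝓝 (S * Real.sqrt 0)) := (continuous_const.mul Real.continuous_sqrt).tendsto 0
    rw [Real.sqrt_zero, mul_zero] at this
    exact this.mono_left nhdsWithin_le_nhds
  have := continuousOn_extension (G := Dz^[k] Ψ) (g₀ := fun _ => 0) (by positivity : (0:ℝ) < π / 2)
    (fun R hR θ hθ => hS R (Ioo_subset_Icc_self hR) θ hθ) hmd hG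
  exact this

/-- **`∂_θV_k` extended by `∂_θV_k(R,0⁺)` is jointly continuous up to `θ = 0`** (on `θ < π/4`).
[cite: Elgindi2021, §7.1 Proposition 7.1 (p. 19 of arXiv:1904.04795)] -/
theorem continuousOn_dθ_ext_zero (k : ℕ) :
    ContinuousOn (fun p : ℝ × ℝ => if p.2 ≤ 0 then dθZeroLim Ψ k p.1 else dθ (Dz^[k] Ψ) p.1 p.2) (Ioi 0 ×ˢ Ico 0 (π / 4)) := by
  refine continuousOn_Ioi_prod_of_local fun a b ha hab => ?_
  obtain ⟨M, -, hM⟩ := h.dθ_rate_zero k ha hab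
  have hsub : Ioo (0:ℝ) (π / 4) ⊆ Ioo 0 (π / 2) := Ioo_subset_Ioo le_rfl (by linarith [Real.pi_pos])
  have hG : ContinuousOn (uncurry (dθ (Dz^[k] Ψ))) (Ioo a b ×ˢ Ioo 0 (π / 4)) :=
    (contDiffOn_dθ_strip (h.smooth_iterate k)).continuousOn.mono fun p hp => ⟨ha.trans hp.1.1, hsub hp.2⟩
  have hmd : Tendsto (fun θ => M * Real.sqrt θ) (𝓝[>] 0) (𝓝 0) := by
    have : Tendsto (fun θ => M * Real.sqrt θ) (𝓝 0) (𝓝 (M * Real.sqrt 0)) := (continuous_const.mul Real.continuous_sqrt).tendsto 0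
    rw [Real.sqrt_zero, mul_zero] at this
    exact this.mono_left nhdsWithin_le_nhds
  exact continuousOn_extension (G := dθ (Dz^[k] Ψ)) (g₀ := dθZeroLim Ψ k) (by positivity : (0:ℝ) < π / 4)
    (fun R hR θ hθ => hM R (Ioo_subset_Icc_self hR) θ hθ) hmd hG

/-- **The boundary value `∂_θV_k(·,0⁺)` is continuous on `(0,∞)`.** [folklore] -/
theorem continuousOn_dθZeroLim (k : ℕ) : ContinuousOn (dθZeroLim Ψ k) (Ioi 0) := by
  have hc := h.continuousOn_dθ_ext_zero k
  have hπ4 : (0:ℝ) < π / 4 := by positivity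
  have hemb : ContinuousOn (fun R : ℝ => (R, (0:ℝ))) (Ioi 0) := (continuous_id.prodMk continuous_const).continuousOn
  have := hc.comp hemb fun R hR => ⟨hR, left_mem_Ico.2 hπ4⟩
  refine this.congr fun R _ => ?_
  simp

end TangentialFamily

end Elgindi

end Literature.Analysis.FluidPDE
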